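import Literature.MathematicalPhysics.QuantumLattice.AnisotropicBandFermiCurveMeasure
import Mathlib.MeasureTheory.Function.JacobianOneDim
import Mathlib.Analysis.SpecialFunctions.Trigonometric.Bounds
import Mathlib.Analysis.SpecialFunctions.Integrability.Basic
import HarnessLib

/-!
# Finiteness of the density-of-states mass of the anisotropic band off the van Hove levels

Cell `gate-hubbard-kl`, item stmt-HubbardSuperconductivity-19294 `LindhardPointwiseIdentification`.
For `a, b > 0` and `μ ≠ ±2(a - b)` the one-dimensional integral of
`AnisotropicBandFermiCurveMeasure.lean`,

  `∫⁻ x in Ico (-π) π, 2/√(4b² - (μ + 2a cos x)²) dx  (= fermiCurveMeasure (k ↦ -2(a cos k₀ + b cos k₁)) μ univ)`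

is finite (`lintegral_anisoDOS_lt_top`): the density of states of the anisotropic band is finite
except at the two van Hove (saddle) energies `±2(a - b)`, where it diverges logarithmically. Proof:
`4b² - (μ + 2a cos x)² = g₁ g₂` with `g₁ + g₂ = 4b`, so `2/√(g₁g₂) ≤ (2/√(2b))(1/√g₁ + 1/√g₂)`, and
`∫₀^π dx/√(c - cos x) < ∞` for `c ≠ 1` (`lintegral_inv_sqrt_sub_cos_lt_top`) by the Jordan-type
bound `cos x₀ - cos x ≥ (4m/π²)(x - x₀)` on `(x₀, π)`, `m = min(x₀, (π - x₀)/2)`, which reduces the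
singularity to `∫ (x - x₀)^{-1/2} < ∞`. Theorems only.

## References
* S. Raghu, S. A. Kivelson, D. J. Scalapino, Phys. Rev. B 81 (2010) 224505, §II (6) (the density
  of states) [RaghuKivelsonScalapino2010].
-/

noncomputable section

open Real Set MeasureTheory MeasureTheory.Measure
open scoped Topology ENNReal

namespace Literature.MathematicalPhysics.QuantumLattice

/-! ### A Jordan-type lower bound for `cos x₀ - cos x` -/

/-- `sin θ ≥ (2/π) min(θ, π - θ)` on `[0, π]` (Jordan's inequality on both halves).
[cite: RaghuKivelsonScalapino2010, §II (6)] -/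
theorem two_div_pi_mul_min_le_sin {θ : ℝ} (h0 : 0 ≤ θ) (hπ : θ ≤ π) :
    2 / π * min θ (π - θ) ≤ Real.sin θ := by
  rcases le_or_gt θ (π / 2) with h | h
  · exact (mul_le_mul_of_nonneg_left (min_le_left _ _) (by positivity)).trans (Real.mul_le_sin h0 h)
  · have h1 : 2 / π * (π - θ) ≤ Real.sin (π - θ) := Real.mul_le_sin (by linarith) (by linarith)
    rw [Real.sin_pi_sub] at h1
    exact (mul_le_mul_of_nonneg_left (min_le_right _ _) (by positivity)).trans h1

/-- **Jordan-type bound**: for `0 < x₀ < x < π`,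
`cos x₀ - cos x ≥ (4 m / π²) (x - x₀)` with `m = min(x₀, (π - x₀)/2) > 0`.
[cite: RaghuKivelsonScalapino2010, §II (6)] -/
theorem cos_sub_cos_ge_linear {x₀ x : ℝ} (h0 : 0 < x₀) (hx : x₀ < x) (hπ : x < π) :
    4 * min x₀ ((π - x₀) / 2) / π ^ 2 * (x - x₀) ≤ Real.cos x₀ - Real.cos x := by
  have hπ0 := Real.pi_pos
  rw [Real.cos_sub_cos, show -2 * Real.sin ((x₀ + x) / 2) * Real.sin ((x₀ - x) / 2) =
    2 * Real.sin ((x₀ + x) / 2) * Real.sin ((x - x₀) / 2) by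
      rw [show (x₀ - x) / 2 = -((x - x₀) / 2) by ring, Real.sin_neg]; ring]
  -- the two sine factors
  have h1 : 2 / π * min x₀ ((π - x₀) / 2) ≤ Real.sin ((x₀ + x) / 2) := by
    have hle := two_div_pi_mul_min_le_sin (θ := (x₀ + x) / 2) (by linarith) (by linarith)
    refine le_trans (mul_le_mul_of_nonneg_left ?_ (by positivity)) hle
    apply le_min
    · exact (min_le_left _ _).trans (by linarith)
    · exact (min_le_right _ _).trans (by linarith)
  have h2 : 2 / π * ((x - x₀) / 2) ≤ Real.sin ((x - x₀) / 2) :=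
    Real.mul_le_sin (by linarith) (by linarith)
  have hm : 0 ≤ 2 / π * min x₀ ((π - x₀) / 2) := by
    have : 0 < min x₀ ((π - x₀) / 2) := lt_min h0 (by linarith)
    positivity
  calc 4 * min x₀ ((π - x₀) / 2) / π ^ 2 * (x - x₀)
      = 2 * (2 / π * min x₀ ((π - x₀) / 2)) * (2 / π * ((x - x₀) / 2)) := by
        field_simp; ring
    _ ≤ 2 * Real.sin ((x₀ + x) / 2) * Real.sin ((x - x₀) / 2) := by
        have h2' : 0 ≤ 2 / π * ((x - x₀) / 2) := by positivity
        nlinarith [mul_le_mul h1 h2 h2' (hm.trans h1)]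

/-! ### `∫₀^π dx / √(c - cos x) < ∞` for `c ≠ 1` -/

/-- **The one-dimensional band-edge integral is finite off the degenerate level**: for `c ≠ 1`,
`∫⁻_{x ∈ (0,π)} 1/√(c - cos x) dx < ∞` (`ENNReal.ofReal`, so the integrand vanishes where
`cos x ≥ c`; at `c = 1` the integrand is `~ 1/x` and the integral diverges).
[cite: RaghuKivelsonScalapino2010, §II (6)] -/
theorem lintegral_inv_sqrt_sub_cos_lt_top {c : ℝ} (hc : c ≠ 1) :
    ∫⁻ x in Ioo (0 : ℝ) π, ENNReal.ofReal (1 / Real.sqrt (c - Real.cos x)) < ∞ := by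
  have hπ0 := Real.pi_pos
  have hvol : volume (Ioo (0 : ℝ) π) < ∞ := by simp
  rcases lt_or_gt_of_ne hc with hc1 | hc1
  · rcases le_or_gt c (-1) with hcm | hcm
    · -- `c ≤ -1`: the integrand vanishes on `(0, π)`
      refine lt_of_le_of_lt (le_of_eq (setLIntegral_eq_zero measurableSet_Ioo fun x hx => ?_)) ENNReal.zero_lt_top
      have : Real.cos π < Real.cos x := Real.cos_lt_cos_of_nonneg_of_le_pi hx.1.le le_rfl hx.2
      rw [Real.cos_pi] at this
      simp only [Pi.zero_apply]
      rw [Real.sqrt_eq_zero'.2 (by linarith), div_zero, ENNReal.ofReal_zero]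
    · -- `-1 < c < 1`: singularity at `x₀ = arccos c`, Jordan bound beyond it
      set x₀ : ℝ := Real.arccos c with hx₀
      have hx₀0 : 0 < x₀ := Real.arccos_pos.2 hc1
      have hx₀π : x₀ < π := Real.arccos_lt_pi.2 hcm
      have hcos : Real.cos x₀ = c := Real.cos_arccos hcm.le hc1.le
      set κ : ℝ := 4 * min x₀ ((π - x₀) / 2) / π ^ 2 with hκ
      have hκ0 : 0 < κ := by
        have : 0 < min x₀ ((π - x₀) / 2) := lt_min hx₀0 (by linarith)
        positivity
      -- split `(0, π) = (0, x₀] ∪ (x₀, π)`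
      have hsplit : Ioo (0 : ℝ) π = Ioc 0 x₀ ∪ Ioo x₀ π := (Ioc_union_Ioo_eq_Ioo hx₀0.le hx₀π).symm
      rw [hsplit]
      refine lt_of_le_of_lt (lintegral_union_le _ _ _) ?_
      rw [ENNReal.add_lt_top]
      constructor
      · -- on `(0, x₀]` the integrand vanishes
        refine lt_of_le_of_lt (le_of_eq (setLIntegral_eq_zero measurableSet_Ioc fun x hx => ?_)) ENNReal.zero_lt_top
        have : Real.cos x₀ ≤ Real.cos x :=
          Real.cos_le_cos_of_nonneg_of_le_pi hx.1.le hx₀π.le hx.2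
        simp only [Pi.zero_apply]
        rw [Real.sqrt_eq_zero'.2 (by linarith), div_zero, ENNReal.ofReal_zero]
      · -- on `(x₀, π)`: `1/√(c - cos x) ≤ 1/√(κ (x - x₀)) = κ^{-1/2} (x - x₀)^{-1/2}`, integrable
        have hint : IntegrableOn (fun x : ℝ => κ ^ (-(1 / 2 : ℝ)) * (x - x₀) ^ (-(1 / 2 : ℝ))) (Ioo x₀ π) := by
          have h1 : IntervalIntegrable (fun x : ℝ => x ^ (-(1 / 2 : ℝ))) volume 0 (π - x₀) :=
            intervalIntegral.intervalIntegrable_rpow' (by norm_num)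
          have h2 := h1.comp_sub_right x₀
          rw [zero_add, sub_add_cancel] at h2
          have h3 : IntegrableOn (fun x : ℝ => (x - x₀) ^ (-(1 / 2 : ℝ))) (Ioo x₀ π) :=
            (h2.1.mono_set Ioo_subset_Ioc_self)
          exact h3.const_mul _
        refine lt_of_le_of_lt (lintegral_mono_ae ?_) hint.lintegral_lt_top
        refine (ae_restrict_mem measurableSet_Ioo).mono fun x hx => ?_
        have hxx : 0 < x - x₀ := by linarith [hx.1]
        have hlow : κ * (x - x₀) ≤ c - Real.cos x := by
          rw [← hcos]; exact cos_sub_cos_ge_linear hx₀0 hx.1 hx.2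
        have hpos : 0 < κ * (x - x₀) := by positivity
        refine ENNReal.ofReal_le_ofReal ?_
        rw [Real.rpow_neg hκ0.le, Real.rpow_neg hxx.le, ← Real.sqrt_eq_rpow, ← Real.sqrt_eq_rpow,
          ← mul_inv, ← Real.sqrt_mul hκ0.le, one_div]
        exact inv_anti₀ (Real.sqrt_pos.2 hpos) (Real.sqrt_le_sqrt hlow)
  · -- `c > 1`: bounded integrand
    refine lt_of_le_of_lt (setLIntegral_mono_ae' measurableSet_Ioo (g := fun _ => ENNReal.ofReal (1 / Real.sqrt (c - 1)))
      (Filter.Eventually.of_forall fun x _ => ?_)) ?_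
    · refine ENNReal.ofReal_le_ofReal ?_
      rw [one_div, one_div]
      exact inv_anti₀ (Real.sqrt_pos.2 (by linarith)) (Real.sqrt_le_sqrt (by linarith [Real.cos_le_one x]))
    · rw [setLIntegral_const]
      exact ENNReal.mul_lt_top ENNReal.ofReal_lt_top hvol

/-- The reflected integral: for `c ≠ -1`, `∫⁻_{x ∈ (0,π)} 1/√(cos x - c) dx < ∞` (substitute
`x ↦ π - x` in `lintegral_inv_sqrt_sub_cos_lt_top`). [cite: RaghuKivelsonScalapino2010, §II (6)] -/
theorem lintegral_inv_sqrt_cos_sub_lt_top {c : ℝ} (hc : c ≠ -1) :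
    ∫⁻ x in Ioo (0 : ℝ) π, ENNReal.ofReal (1 / Real.sqrt (Real.cos x - c)) < ∞ := by
  have hderiv : ∀ x ∈ Ioo (0 : ℝ) π, HasDerivWithinAt (fun x : ℝ => π - x) (-1 : ℝ) (Ioo (0 : ℝ) π) x :=
    fun x _ => ((hasDerivAt_id x).const_sub π).hasDerivWithinAt
  have hinj : InjOn (fun x : ℝ => π - x) (Ioo (0 : ℝ) π) := fun x _ y _ h => by simpa using h
  have h := lintegral_image_eq_lintegral_abs_deriv_mul measurableSet_Ioo hderiv hinj
    (fun x => ENNReal.ofReal (1 / Real.sqrt ((-c) - Real.cos x)))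
  have himg : (fun x : ℝ => π - x) '' Ioo (0 : ℝ) π = Ioo (0 : ℝ) π := by
    rw [Set.image_const_sub_Ioo]; simp
  rw [himg] at h
  simp only [abs_neg, abs_one, ENNReal.ofReal_one, one_mul, Real.cos_pi_sub] at h
  have hfun : (fun x : ℝ => ENNReal.ofReal (1 / Real.sqrt (Real.cos x - c))) =
      fun x : ℝ => ENNReal.ofReal (1 / Real.sqrt (-c - -Real.cos x)) := by
    funext x; congr 2; ring
  rw [hfun, ← h]
  exact lintegral_inv_sqrt_sub_cos_lt_top (by intro h1; exact hc (by linarith))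

/-- Evenness: `∫⁻_{(-π,0)} F(cos x) dx = ∫⁻_{(0,π)} F(cos x) dx` for every `F : ℝ → ℝ≥0∞`.
[cite: RaghuKivelsonScalapino2010, §II (6)] -/
theorem lintegral_comp_cos_Ioo_neg_pi (F : ℝ → ℝ≥0∞) :
    ∫⁻ x in Ioo (-π) (0 : ℝ), F (Real.cos x) = ∫⁻ x in Ioo (0 : ℝ) π, F (Real.cos x) := by
  have hderiv : ∀ x ∈ Ioo (0 : ℝ) π, HasDerivWithinAt (fun x : ℝ => -x) (-1 : ℝ) (Ioo (0 : ℝ) π) x :=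
    fun x _ => (hasDerivAt_neg x).hasDerivWithinAt
  have hinj : InjOn (fun x : ℝ => -x) (Ioo (0 : ℝ) π) := fun x _ y _ h => by simpa using h
  have h := lintegral_image_eq_lintegral_abs_deriv_mul measurableSet_Ioo hderiv hinj (fun x => F (Real.cos x))
  have himg : (fun x : ℝ => -x) '' Ioo (0 : ℝ) π = Ioo (-π) 0 := by
    rw [show (fun x : ℝ => -x) = Neg.neg from rfl, Set.image_neg_Ioo, neg_zero]
  rw [himg] at h
  simpa only [abs_neg, abs_one, ENNReal.ofReal_one, one_mul, Real.cos_neg] using h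

/-- From `(0, π)` to `[-π, π)`: if `∫⁻_{(0,π)} F(cos x) < ∞` then `∫⁻_{[-π,π)} F(cos x) < ∞`.
[cite: RaghuKivelsonScalapino2010, §II (6)] -/
theorem lintegral_comp_cos_Ico_lt_top {F : ℝ → ℝ≥0∞}
    (hF : ∫⁻ x in Ioo (0 : ℝ) π, F (Real.cos x) < ∞) :
    ∫⁻ x in Ico (-π) π, F (Real.cos x) < ∞ := by
  have hπ0 := Real.pi_pos
  have h1 : Ico (-π) π ⊆ Ioo (-π) 0 ∪ ({-π} ∪ {0}) ∪ Ioo 0 π := by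
    intro x hx
    rcases lt_trichotomy x 0 with h | h | h
    · rcases eq_or_lt_of_le hx.1 with h' | h'
      · exact Or.inl (Or.inr (Or.inl h'.symm))
      · exact Or.inl (Or.inl ⟨h', h⟩)
    · exact Or.inl (Or.inr (Or.inr h))
    · exact Or.inr ⟨h, hx.2⟩
  have hnull : volume (({-π} ∪ {0} : Set ℝ)) = 0 := by
    rw [measure_union_null_iff]; simp
  refine lt_of_le_of_lt (lintegral_mono_set h1) ?_
  refine lt_of_le_of_lt (lintegral_union_le _ _ _) ?_
  rw [ENNReal.add_lt_top]
  refine ⟨lt_of_le_of_lt (lintegral_union_le _ _ _) ?_, hF⟩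
  rw [ENNReal.add_lt_top, lintegral_comp_cos_Ioo_neg_pi]
  exact ⟨hF, by rw [setLIntegral_measure_zero _ _ hnull]; exact ENNReal.zero_lt_top⟩

/-! ### Finiteness of the density-of-states mass off the van Hove levels -/

/-- **The total density-of-states mass of the anisotropic band is finite off the van Hove levels**:
for `a, b > 0` and `μ ≠ ±2(a - b)`,
`∫⁻ x in Ico (-π) π, 2/√(4b² - (μ + 2a cos x)²) dx < ∞`
(`= fermiCurveMeasure (k ↦ -2(a cos k₀ + b cos k₁)) μ univ` by `fermiCurveMeasure_anisoBand_univ`).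
[cite: RaghuKivelsonScalapino2010, §II (6)] -/
theorem lintegral_anisoDOS_lt_top (a b μ : ℝ) (ha : 0 < a) (hb : 0 < b)
    (h₁ : μ ≠ 2 * (b - a)) (h₂ : μ ≠ 2 * (a - b)) :
    ∫⁻ x in Ico (-π) π, ENNReal.ofReal (2 / Real.sqrt (4 * b ^ 2 - (μ + 2 * a * Real.cos x) ^ 2)) < ∞ := by
  set c₁ : ℝ := (2 * b - μ) / (2 * a) with hc₁
  set c₂ : ℝ := -(2 * b + μ) / (2 * a) with hc₂
  set C : ℝ := 2 / (Real.sqrt (2 * b) * Real.sqrt (2 * a)) with hC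
  have hC0 : 0 ≤ C := by positivity
  -- pointwise domination
  have hdom : ∀ x : ℝ, ENNReal.ofReal (2 / Real.sqrt (4 * b ^ 2 - (μ + 2 * a * Real.cos x) ^ 2)) ≤
      ENNReal.ofReal C * (ENNReal.ofReal (1 / Real.sqrt (c₁ - Real.cos x)) +
        ENNReal.ofReal (1 / Real.sqrt (Real.cos x - c₂))) := by
    intro x
    set g₁ : ℝ := 2 * b - μ - 2 * a * Real.cos x with hg₁
    set g₂ : ℝ := 2 * b + μ + 2 * a * Real.cos x with hg₂
    have hg : 4 * b ^ 2 - (μ + 2 * a * Real.cos x) ^ 2 = g₁ * g₂ := by rw [hg₁, hg₂]; ring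
    have hsum : g₁ + g₂ = 4 * b := by rw [hg₁, hg₂]; ring
    have hg₁' : g₁ = 2 * a * (c₁ - Real.cos x) := by rw [hg₁, hc₁]; field_simp
    have hg₂' : g₂ = 2 * a * (Real.cos x - c₂) := by rw [hg₂, hc₂]; field_simp; ring
    rw [← ENNReal.ofReal_add (by positivity) (by positivity), ← ENNReal.ofReal_mul hC0]
    refine ENNReal.ofReal_le_ofReal ?_
    rw [hg]
    rcases le_or_gt (g₁ * g₂) 0 with hle | hpos
    · rw [Real.sqrt_eq_zero'.2 hle, div_zero]; positivity
    · -- both factors positive, one of them `≥ 2b`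
      have hg₁0 : 0 < g₁ := by
        by_contra h
        have : g₁ * g₂ ≤ 0 := mul_nonpos_of_nonpos_of_nonneg (le_of_not_gt h) (by linarith [le_of_not_gt h])
        linarith
      have hg₂0 : 0 < g₂ := by
        by_contra h
        have : g₁ * g₂ ≤ 0 := mul_nonpos_of_nonneg_of_nonpos hg₁0.le (le_of_not_gt h)
        linarith
      have hx₁ : 0 < c₁ - Real.cos x := by
        have : 0 < 2 * a * (c₁ - Real.cos x) := by rw [← hg₁']; exact hg₁0
        exact pos_of_mul_pos_right this (by positivity)
      have hx₂ : 0 < Real.cos x - c₂ := by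
        have : 0 < 2 * a * (Real.cos x - c₂) := by rw [← hg₂']; exact hg₂0
        exact pos_of_mul_pos_right this (by positivity)
      have hA : 0 < 1 / Real.sqrt (c₁ - Real.cos x) := by positivity
      have hB : 0 < 1 / Real.sqrt (Real.cos x - c₂) := by positivity
      rcases le_total (2 * b) g₂ with hbig | hbig
      · -- `g₂ ≥ 2b`: `g₁ g₂ ≥ (2b) g₁`
        have hlow : 2 * b * g₁ ≤ g₁ * g₂ := by nlinarith
        calc 2 / Real.sqrt (g₁ * g₂) ≤ 2 / Real.sqrt (2 * b * g₁) :=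
              div_le_div_of_nonneg_left (by norm_num) (Real.sqrt_pos.2 (by positivity)) (Real.sqrt_le_sqrt hlow)
          _ = C * (1 / Real.sqrt (c₁ - Real.cos x)) := by
              rw [hg₁', hC, show 2 * b * (2 * a * (c₁ - Real.cos x)) = (2 * b) * (2 * a) * (c₁ - Real.cos x) by ring,
                Real.sqrt_mul (by positivity), Real.sqrt_mul (by positivity)]
              field_simp
          _ ≤ C * (1 / Real.sqrt (c₁ - Real.cos x) + 1 / Real.sqrt (Real.cos x - c₂)) := by
              gcongr; linarith
      · -- `g₁ ≥ 2b`
        have hbig' : 2 * b ≤ g₁ := by linarith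
        have hlow : 2 * b * g₂ ≤ g₁ * g₂ := by nlinarith
        calc 2 / Real.sqrt (g₁ * g₂) ≤ 2 / Real.sqrt (2 * b * g₂) :=
              div_le_div_of_nonneg_left (by norm_num) (Real.sqrt_pos.2 (by positivity)) (Real.sqrt_le_sqrt hlow)
          _ = C * (1 / Real.sqrt (Real.cos x - c₂)) := by
              rw [hg₂', hC, show 2 * b * (2 * a * (Real.cos x - c₂)) = (2 * b) * (2 * a) * (Real.cos x - c₂) by ring,
                Real.sqrt_mul (by positivity), Real.sqrt_mul (by positivity)]
              field_simp
          _ ≤ C * (1 / Real.sqrt (c₁ - Real.cos x) + 1 / Real.sqrt (Real.cos x - c₂)) := by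
              gcongr; linarith
  -- the two one-dimensional integrals are finite
  have hc₁1 : c₁ ≠ 1 := by
    rw [hc₁]; intro h
    rw [div_eq_one_iff_eq (by positivity)] at h
    exact h₁ (by linarith)
  have hc₂1 : c₂ ≠ -1 := by
    rw [hc₂]; intro h
    rw [div_eq_iff (by positivity)] at h
    exact h₂ (by linarith)
  have hI₁ : ∫⁻ x in Ico (-π) π, ENNReal.ofReal (1 / Real.sqrt (c₁ - Real.cos x)) < ∞ :=
    lintegral_comp_cos_Ico_lt_top (F := fun u => ENNReal.ofReal (1 / Real.sqrt (c₁ - u)))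
      (lintegral_inv_sqrt_sub_cos_lt_top hc₁1)
  have hI₂ : ∫⁻ x in Ico (-π) π, ENNReal.ofReal (1 / Real.sqrt (Real.cos x - c₂)) < ∞ :=
    lintegral_comp_cos_Ico_lt_top (F := fun u => ENNReal.ofReal (1 / Real.sqrt (u - c₂)))
      (lintegral_inv_sqrt_cos_sub_lt_top hc₂1)
  have hm₁ : Measurable fun x : ℝ => ENNReal.ofReal (1 / Real.sqrt (c₁ - Real.cos x)) :=
    (by fun_prop : Measurable fun x : ℝ => 1 / Real.sqrt (c₁ - Real.cos x)).ennreal_ofReal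
  refine lt_of_le_of_lt (lintegral_mono fun x => hdom x) ?_
  rw [lintegral_const_mul' _ _ ENNReal.ofReal_ne_top, lintegral_add_left hm₁]
  exact ENNReal.mul_lt_top ENNReal.ofReal_lt_top (ENNReal.add_lt_top.2 ⟨hI₁, hI₂⟩)

end Literature.MathematicalPhysics.QuantumLattice

end
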